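import Summits.QuantumFields.BalabanUV.Beta.D1BFx.TorusCombKKT
import Summits.QuantumFields.BalabanUV.Beta.FP.RelInvPeriodisedComb

/-!
# `BalabanUV.Beta.D1BFx.TorusCombKKTSh` — road «BF-x», binder row D1, slot (K), PART 23 «PART 8‴ COMB SKELETON» (an2 R-D1-g43-1, OWNER d1-p2 g22
# `PART23-COMB-SKELETON-SPEC`), brick **TB1′ «M-SIDE ON THE TORUS AT THE CHART OF RECORD (III′)»** — the comb twin of `TorusCombKKT` (TB1):
# ON EVERY COARSE TORUS THE COMB-GAUGED SHARP KKT MATRIX OF THE (0.4)-SYMMETRISED ROOTED BORDERED HESSIAN, `M′_T := kkt K̂ (fromRows Q̂′ τ_T)`,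
# `Q̂′ := (fBL (sortK n (bhK n + Dsh n)))^` (Bałaban's straight block averaging SHIFTED by an1's symmetrised border `Dsh`, i.e. `Q̂′ = Q̂ + D̂sh`),
# comb rows at the CENTRED root `ρ_c = ctr (d+1) n`, IS INVERTIBLE, AND THE ff BLOCK OF `M′_T⁻¹` IS THE PERIODISATION OF THE ff LEG OF THE INTERIOR
# COMB KERNEL `GcombSh n 0` — from the tree's `ℤ^{d+1}` relative rules at chart (III′) (road «FP» leaf-05 g29 ∕ an2 g35:
# `FP/RelInvPeriodisedComb.relInv_GcombSh_bhKStepSh 0` = `RelInv (GcombSh n 0) (bhKStepSh d n (Dsh n) 0) (axEc ρ_c n)`, `bhKStepSh … 0 = bhK n + Dsh n`),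
# periodised in THIS lineage's sorted currency (`SortedRelInv.torus_relInv_rules_blocks`) and fed to the row-D1 owner's finite bridge
# (`RelInvCombBorderedKKT`) EXACTLY as TB1 does for the bm chart.

WHY (R-D1-g43-1 (i): «PART 23 := PART 8‴ COMB SKELETON = `tshot_eq_hptw_form` at `(GcombSh n 0, S⁰, W⁰)` …; the ≈ 20 N-side ∕ combine modules +
PARTs 8 ∕ 8-NN ∕ 10 have no twin yet — the road schedules»; leaf-03 g27 `N-g27-1-LOCATED-COUNT.md` §2 (a)).  Every module of the K-combine chain
(`KCombineCov` §3 `identity_array_currency_cov`: `K₀ := Khat n p`, `Q₀ := Qhat n p`, `τ := tauT ρ n p`, `det M_T ≠ 0` by `TorusCombKKT.isUnit_det_MT`;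
the M-socket `KLimitAxial`; the N-side `PackedBlockGlue.response_siteOf_eq_tsum_colH`) reads the bm chart through TB1's three theorems; this file is
their (III′) socket.  LOCATED FACTS it records (all [folklore], read off tree definitions): (1) the ff block of the legged border is UNCHANGED —
`(fTL (sortK n (bhK n + Dsh n)))^ = K̂` ((Dff) `DshAn1.Dsh_inl_inl`); (2) the mf block is SHIFTED — `Q̂′ = Q̂ + D̂sh`, `D̂sh := (fBL (sortK n (Dsh n)))^`
(the coarse gradient of an1's normalised symmetrised block potential `lam04`); (3) the fm block is `−Q̂′ᵀ` and the mm block `0`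
(`FP/RelInvPeriodisedComb.trK_bhKStepSh`, `bhKStepSh_inr_inr`), so `(sortK n (bhK n + Dsh n))^ = kkt K̂ Q̂′ · diag(1, −1)` — the `kkt` convention holds
verbatim; (4) hence TB1's §4 re-elaborates with `(G₀^{bm}, bhK, axEc (toSite r), Q̂) ↦ (GcombSh n 0, bhK + Dsh, axEc ρ_c, Q̂′)`.
NOT HERE (next bricks of the twin chain, each its own file): TB3′ = the ROOTED-AXIAL gauge basis on the torus (`Π̂′ := (trK (piK ρ_c n))^`,
`Ŵ′₀ := (1 − Π̂′)·τ_Tᵀ`, letters `K̂·Ŵ′₀ = 0`, `Q̂′·Ŵ′₀ = 0`, `τ_T·Ŵ′₀ = 1` from an2's `CombChartSpreadBlind.comp_bhKSym_trK_piK` — the (0.4) border is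
blind to the CENTRED COMB dressing, NOT to the block-mean one), the M-socket twin of `KLimitAxial`, the N-side response column `= colH (GcombSh n 0)`.

HONEST FRAMING (cell contract, verbatim): «discharging `BetaPertH` makes Bałaban's UV stability UNCONDITIONAL — a real constructive-QFT
result; it is NOT the continuum limit and NOT the Clay problem.»  HONEST DEPENDENCY (verbatim): «continuum YM on T⁴ ⇐ BetaPertH ∧ nine
spine estimates (0/9 proved); BetaPertH ⇐ (D1) ∧ (D4) ∧ CAP+tail; G-an2-4 gates asym, D1 and NE2/3/4.»  [folklore] bookkeeping + finite linear
algebra over tree objects BY NAME; no `Prop` is minted, nothing is cited, no wall binder is instantiated; 0 sorry.  Discharges NOTHING of (K), of the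
four row-D1 binders (hW ∕ hR ∕ D1Tel ∕ D1Rep), of D1 or of BetaPertH; NOT continuum, NOT Clay.
ABSOLUTE RULE (cell, verbatim): «No internally-minted statement may enter as a cited fact. Every hypothesis is either kernel-proved in this package
or a verbatim quotation of a PUBLISHED theorem with page reference. The manuscript(s) under audit are NOT citable for their own disputed steps — they
are the thing under adjudication; programme-internal (2001/route/tribunal) claims are never citable.»

CONTENT (all [folklore]; every `d`, block side `n ≥ 1`, coarse period `p ≥ 1`; root `ρ_c = ctr (d+1) n`):
* §1 lattice letters of the (III′) triple in the sorted currency: `GcombSh_inr_row_off`, `bhKStepSh_zero_inr_row_off` (multiplier rows vanish off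
  the coarse sublattice); **`torus_rules_comb`** — the four relative rules on every coarse torus for `(GcombSh n 0, bhKStepSh d n (Dsh n) 0, axEc ρ_c n)`.
* §2 [our objects] `DshHat n p`, **`QhatSh n p`** (`Q̂′`); `fTL_sortK_bhKStepSh_zero_eq_Khat` (`K̂` unchanged), `QhatSh_eq_Qhat_add_DshHat` (`Q̂′ = Q̂ + D̂sh`),
  `fTR_sortK_bhKStepSh_zero`, `fBR_sortK_bhKStepSh_zero`, **`blocksHat_sortK_bhKStepSh_zero`** (`= kkt K̂ Q̂′ · fromBlocks 1 0 0 (−1)`).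
* §3 **`isUnit_det_MTsh`**, **`flucCov_MTsh_eq`**, **`inv_MTsh_packed_eq`** — `IsUnit (kkt K̂ (fromRows Q̂′ τ_T)).det`,
  `flucCov K̂ (fromRows Q̂′ τ_T) = (reblock n (blk (GcombSh n 0) true true))^`, `(M′_T⁻¹).submatrix e e = diag(1,−1)·(sortK n (GcombSh n 0))^`
  (`e = Sum.map id Sum.inl`), `τ_T := tauT (ctr (d+1) n) n p`.
Provenance: D1 formalisation swarm, unit `b2b-balaban-beta-d1-formalise-leaf-03` (gen 28), brick «K-TB1′», 2026-08-22; template `TorusCombKKT` (gen 8, p239667-lineage);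
letters of road «FP» (`FP/RelInvPeriodisedComb`, leaf-05 g29) and an2 (`CombChartStepJets`, `RelInvFactorSandwich`) BY NAME; no existing file touched.
-/

noncomputable section

namespace Summit.QuantumFields.BalabanUV.Beta.D1BFx.TorusCombKKTSh

open Matrix
open Literature.Probability.LatticeModels (TorusSite Torus.proj)
open Literature.MathematicalPhysics.QuantumFieldTheory.Balaban1983to89
open Literature.MathematicalPhysics.QuantumFieldTheory.Balaban1983to89.Beta
open Literature.MathematicalPhysics.QuantumFieldTheory.Balaban1983to89.Beta.Composition (kkt)
open Literature.MathematicalPhysics.QuantumFieldTheory.Balaban1983to89.Beta.CompositionSingular (flucCov)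
open ExpKernelCalculus (MKer comp shiftK)
open AffineAveraging (box toSite)
open AveragingContoursRooted (ctr ctrOff ctrOff_mem_box)
open OneStepResolventKernel (Fib)
open Summit.QuantumFields.BalabanUV.Beta.TameKernelCalculus (Spr trK trK_apply)
open Summit.QuantumFields.BalabanUV.Beta.ChartConjugationRelative (RelInv)
open Summit.QuantumFields.BalabanUV.Beta.AxialDressingRooted (axEc spr_axEc piK piK_inl_inr piK_inr_inr coDressKAt coDressKAt_eq
  comp_inr_row_eq_zero)
open Summit.QuantumFields.BalabanUV.Beta.BorderedHessian (bhK bhK_inr_row_off sgnF sgnF_inl sgnF_inr sgnK_apply spr_bhK)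
open Summit.QuantumFields.BalabanUV.Beta.SymShiftedSpread (bhKStepSh bhKStepSh_zero)
open Summit.QuantumFields.BalabanUV.Beta.DshAn1 (Dsh Dsh_inl_inl Dsh_inl_inr Dsh_inr_inl Dsh_inr_inr spr_Dsh)
open Summit.QuantumFields.BalabanUV.Beta.SymmetrisedStepJets (Gsym)
open Summit.QuantumFields.BalabanUV.Beta.RelInvFactorSandwich (Gsym_inr_row_coarse)
open Summit.QuantumFields.BalabanUV.Beta.CombChartStepJets (GcombSh GcombSh_apply)
open Summit.QuantumFields.BalabanUV.Beta.CombChartContactFactor (spr_GcombSh)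
open Summit.QuantumFields.BalabanUV.Beta.FP.RelInvPeriodisedComb (relInv_GcombSh_bhKStepSh spr_bhKStepSh_Dsh shiftK_bhKStepSh shiftK_GcombSh'
  shiftK_Dsh bhKStepSh_inr_inr trK_bhKStepSh)
open Summit.QuantumFields.BalabanUV.Beta.RelInvCombBorderedKKT (isUnit_det_kkt_fromRows_of_relInv blocks_kkt_fromRows_of_relInv)
open Summit.QuantumFields.BalabanUV.Beta.D1BFx.FibredPeriodisation
open Summit.QuantumFields.BalabanUV.Beta.D1BFx.SortedKernels
open Summit.QuantumFields.BalabanUV.Beta.D1BFx.SortedReblocking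
open Summit.QuantumFields.BalabanUV.Beta.D1BFx.SortedPack
open Summit.QuantumFields.BalabanUV.Beta.D1BFx.SortedRelInv
open Summit.QuantumFields.BalabanUV.Beta.D1BFx.TorusCombKKT
open scoped BigOperators

variable {d : ℕ}

/-! ## §1 The (III′) triple is admissible for the sorted periodisation; its four rules on every coarse torus -/

section Lattice
variable (n : ℕ) [NeZero n]

/-- [folklore] Multiplier ROWS of the interior comb kernel `GcombSh n j = Π_cᵀ ∘ Gsym_j ∘ Π_c` vanish off the coarse sublattice (the row `(inr m, x)`
of `trK (piK ρ_c n) ∘ Gsym_j` is the row of `Gsym_j`, coarse by `RelInvFactorSandwich.Gsym_inr_row_coarse`). -/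
theorem GcombSh_inr_row_off (j : ℕ) {x : Fin (d + 1) → ℤ} (hx : Torus.proj n x ≠ 0) (z : Fin (d + 1) → ℤ) (m : Fin (d + 1)) (b : Fib d) :
    GcombSh (d := d) n j x z (Sum.inr m) b = 0 := by
  rw [GcombSh_apply, coDressKAt_eq]
  refine comp_inr_row_eq_zero _ _ (fun y f => ?_) z b
  unfold ExpKernelCalculus.comp
  have h : ∀ u, ∑ g : Fib d, trK (piK (ctr (d + 1) n) n) x u (Sum.inr m) g * Gsym (d := d) n j u y g f = 0 := by
    intro u
    rw [Fintype.sum_sum_type]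
    simp only [trK_apply, piK_inl_inr, zero_mul, Finset.sum_const_zero, zero_add, piK_inr_inr]
    refine Finset.sum_eq_zero fun m' _ => ?_
    split_ifs with h
    · rw [h.1, Gsym_inr_row_coarse j x y m' f hx]; ring
    · rw [zero_mul]
  simp_rw [h]
  exact tsum_zero

/-- [folklore] Multiplier ROWS of the level-`0` legged border `bhKStepSh d n (Dsh n) 0 = bhK n + Dsh n` vanish off the coarse sublattice
(`bhK_inr_row_off`; `Dsh_inr_inl` carries the factor `[proj n x = 0]`, `Dsh_inr_inr = 0`). -/
theorem bhKStepSh_zero_inr_row_off {x : Fin (d + 1) → ℤ} (hx : Torus.proj n x ≠ 0) (z : Fin (d + 1) → ℤ) (m : Fin (d + 1)) (b : Fib d) :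
    bhKStepSh d n (Dsh n) 0 x z (Sum.inr m) b = 0 := by
  rw [bhKStepSh_zero]
  show bhK n x z (Sum.inr m) b + Dsh n x z (Sum.inr m) b = 0
  rw [bhK_inr_row_off n hx]
  rcases b with β | m'
  · rw [Dsh_inr_inl, if_neg hx, add_zero]
  · rw [Dsh_inr_inr, add_zero]

variable {n} (p : ℕ) [NeZero p]

/-- [folklore] **THE FOUR RULES ON THE TORUS FOR THE (III′) TRIPLE** `(G′, 𝕄′, E) := (GcombSh n 0, bhKStepSh d n (Dsh n) 0, axEc ρ_c n)` (block matrices over the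
coarse torus `Site (d+1) p`): `Ê·Ĝ′ = Ĝ′`, `Ĝ′·Ê = Ĝ′`, `Ĝ′·𝕄̂′·Ê = Ê`, `Ê·𝕄̂′·Ĝ′ = Ê` — `SortedRelInv.torus_relInv_rules_blocks` at the chart-(III′) letters of
road «FP» (`relInv_GcombSh_bhKStepSh 0`, `spr_GcombSh`, `spr_bhKStepSh_Dsh`, `shiftK_GcombSh'`, `shiftK_bhKStepSh`) and §1. -/
theorem torus_rules_comb :
    blocksHat p (sortK n (axEc (ctr (d + 1) n) n)) * blocksHat p (sortK n (GcombSh (d := d) n 0)) = blocksHat p (sortK n (GcombSh (d := d) n 0)) ∧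
      blocksHat p (sortK n (GcombSh (d := d) n 0)) * blocksHat p (sortK n (axEc (ctr (d + 1) n) n)) = blocksHat p (sortK n (GcombSh (d := d) n 0)) ∧
      blocksHat p (sortK n (GcombSh (d := d) n 0)) * blocksHat p (sortK n (bhKStepSh d n (Dsh n) 0))
          * blocksHat p (sortK n (axEc (ctr (d + 1) n) n)) = blocksHat p (sortK n (axEc (ctr (d + 1) n) n)) ∧
      blocksHat p (sortK n (axEc (ctr (d + 1) n) n)) * blocksHat p (sortK n (bhKStepSh d n (Dsh n) 0))
          * blocksHat p (sortK n (GcombSh (d := d) n 0)) = blocksHat p (sortK n (axEc (ctr (d + 1) n) n)) :=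
  torus_relInv_rules_blocks (p := p) (relInv_GcombSh_bhKStepSh (d := d) (Lc := n) 0)
    (spr_GcombSh (d := d) (Lc := n) 0) (spr_bhKStepSh_Dsh (d := d) (Lc := n) 0) (spr_axEc _ _)
    (fun t => shiftK_GcombSh' (d := d) (Lc := n) 0 t) (fun t => shiftK_bhKStepSh (d := d) (Lc := n) t 0) (fun t => shiftK_axEc _ t)
    (fun _ z f b hy => GcombSh_inr_row_off n 0 hy z f b) (fun _ z f b hy => bhKStepSh_zero_inr_row_off n hy z f b)
    (fun _ z f b hy => axEc_inr_row_off _ hy z f b)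

end Lattice

/-! ## §2 The periodised legged border is `kkt K̂ Q̂′ · diag(1, −1)`, `Q̂′ = Q̂ + D̂sh` -/

section BhKSym
variable (n p : ℕ) [NeZero n] [NeZero p]

/-- [our object] `D̂sh`: the torus matrix of the mf block of an1's symmetrised border shift `Dsh n` (coarse bonds × fine bonds) — the coarse gradient of
the normalised symmetrised block potential `lam04` read as averaging rows. -/
def DshHat : Matrix (J d p) (I d n p) ℝ := Matrix.of (periodiseF p (fBL (sortK n (Dsh (d := d) n))))

/-- [our object] **`Q̂′`**: the torus matrix of the (0.4)-SYMMETRISED block averaging — the mf block of the level-`0` legged border `bhK n + Dsh n`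
(coarse bonds × fine bonds, fine bonds re-blocked over the coarse torus). -/
def QhatSh : Matrix (J d p) (I d n p) ℝ := Matrix.of (periodiseF p (fBL (sortK n (bhKStepSh d n (Dsh (d := d) n) 0))))

/-- [folklore] **THE ff BLOCK IS UNCHANGED**: `(fTL (sortK n (bhK n + Dsh n)))^ = K̂` ((Dff) `Dsh_inl_inl`). -/
theorem fTL_sortK_bhKStepSh_zero_eq_Khat :
    Matrix.of (periodiseF p (fTL (sortK n (bhKStepSh d n (Dsh (d := d) n) 0)))) = Khat (d := d) n p := by
  rw [Khat]
  congr 2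
  funext ⟨y, z, κ⟩ ⟨y', z', l⟩
  show sortK n (bhKStepSh d n (Dsh n) 0) (y, Sum.inl (z, κ)) (y', Sum.inl (z', l)) = sortK n (bhK n) (y, Sum.inl (z, κ)) (y', Sum.inl (z', l))
  rw [sortK_inl_inl, sortK_inl_inl, bhKStepSh_zero]
  show bhK n _ _ _ _ + Dsh n _ _ _ _ = _
  rw [Dsh_inl_inl, add_zero]

/-- [folklore] **THE mf BLOCK IS SHIFTED**: `Q̂′ = Q̂ + D̂sh` (additivity of the periodisation on the absolutely summable sorted fibres of the two spread packs). -/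
theorem QhatSh_eq_Qhat_add_DshHat : QhatSh (d := d) n p = Qhat (d := d) n p + DshHat (d := d) n p := by
  have hb : ∀ a b x, Summable (Kfib (fBL (sortK n (bhK (d := d) n))) a b x) := fun a b x =>
    (hyp_rows (n := n) (spr_bhK (d := d) (N := n) (NeZero.one_le)) (Sum.inr a) (Sum.inl b) x).of_abs
  have hD : ∀ a b x, Summable (Kfib (fBL (sortK n (Dsh (d := d) n))) a b x) := fun a b x =>
    (hyp_rows (n := n) (spr_Dsh (d := d) (N := n) (NeZero.one_le)) (Sum.inr a) (Sum.inl b) x).of_abs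
  have hsum : fBL (sortK n (bhKStepSh d n (Dsh (d := d) n) 0)) = fBL (sortK n (bhK (d := d) n)) + fBL (sortK n (Dsh (d := d) n)) := by
    funext i j
    obtain ⟨y, m⟩ := i
    obtain ⟨y', z', l⟩ := j
    rw [Pi.add_apply, Pi.add_apply]
    simp only [fBL]
    rw [sortK_inr_inl, sortK_inr_inl, sortK_inr_inl, bhKStepSh_zero, Pi.add_apply, Pi.add_apply, Pi.add_apply, Pi.add_apply]
  ext i j
  rw [QhatSh, Qhat, DshHat, Matrix.add_apply, Matrix.of_apply, Matrix.of_apply, Matrix.of_apply, hsum, periodiseF_add hb hD]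

/-- [folklore] The fm block of the legged border is MINUS the transpose of its mf block (`trK_bhKStepSh 0`), in sorted form. -/
theorem fTR_sortK_bhKStepSh_zero :
    fTR (sortK n (bhKStepSh d n (Dsh (d := d) n) 0)) = fun i j => -(trF (fBL (sortK n (bhKStepSh d n (Dsh (d := d) n) 0))) i j) := by
  funext ⟨y, z, κ⟩ ⟨y', l⟩
  rw [trF_apply]
  show sortK n (bhKStepSh d n (Dsh n) 0) (y, Sum.inl (z, κ)) (y', Sum.inr l)
    = -(sortK n (bhKStepSh d n (Dsh n) 0) (y', Sum.inr l) (y, Sum.inl (z, κ)))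
  rw [sortK_inl_inr, sortK_inr_inl]
  have h := congrFun (congrFun (congrFun (congrFun (trK_bhKStepSh (d := d) (Lc := n) 0) (finePt n y z)) ((n : ℤ) • y')) (Sum.inl κ)) (Sum.inr l)
  rw [trK_apply, sgnK_apply, sgnF_inl, sgnF_inr] at h
  rw [h]; ring

omit [NeZero p] in
/-- [folklore] The mm block of the legged border vanishes, in sorted form (`bhKStepSh_inr_inr`). -/
theorem fBR_sortK_bhKStepSh_zero : fBR (sortK n (bhKStepSh d n (Dsh (d := d) n) 0)) = fun _ _ => (0 : ℝ) := by
  funext ⟨y, m⟩ ⟨y', m'⟩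
  show sortK n (bhKStepSh d n (Dsh n) 0) (y, Sum.inr m) (y', Sum.inr m') = 0
  rw [sortK_inr_inr, bhKStepSh_inr_inr]

/-- [folklore] Block covariance of the sorted legged border: jointly periodic fibres (`shiftK_bhKStepSh`). -/
theorem isPeriodic₂_sortK_bhKStepSh_zero (q : ℕ) : ∀ i j, IsPeriodic₂ q (Kfib (sortK n (bhKStepSh d n (Dsh (d := d) n) 0)) i j) :=
  isPeriodic₂_sortK (fun t => shiftK_bhKStepSh (d := d) (Lc := n) t 0) q

/-- [folklore] **`(sortK n (bhK n + Dsh n))^ = kkt K̂ Q̂′ · fromBlocks 1 0 0 (−1)`** — the (0.4)-symmetrised legged border `[[d*d, −(𝒬+𝒟)ᵀ],[𝒬+𝒟, 0]]`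
on the torus is the model's `kkt` with the sign of the multiplier COLUMNS flipped (pattern `TorusCombKKT.blocksHat_sortK_bhK`). -/
theorem blocksHat_sortK_bhKStepSh_zero :
    blocksHat p (sortK n (bhKStepSh d n (Dsh (d := d) n) 0))
      = kkt (Khat (d := d) n p) (QhatSh (d := d) n p) * Matrix.fromBlocks (1 : Matrix (I d n p) (I d n p) ℝ) 0 0 (-1 : Matrix (J d p) (J d p) ℝ) := by
  rw [kkt, Matrix.fromBlocks_multiply]
  simp only [Matrix.mul_one, Matrix.mul_zero, add_zero, zero_add, Matrix.mul_neg, neg_zero]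
  rw [blocksHat, ← fTL_sortK_bhKStepSh_zero_eq_Khat]
  congr 1
  · -- fm block: `−Q̂′ᵀ`
    ext ⟨x, z, κ⟩ ⟨y, l⟩
    rw [Matrix.neg_apply, Matrix.transpose_apply, QhatSh, Matrix.of_apply, Matrix.of_apply, fTR_sortK_bhKStepSh_zero, periodiseF_neg,
      periodiseF_trF_apply (fun a b => isPeriodic₂_sortK_bhKStepSh_zero n p (Sum.inr a) (Sum.inl b))]
  · -- mm block: `0`
    rw [fBR_sortK_bhKStepSh_zero, periodiseF_zero]

end BhKSym

/-! ## §3 `M′_T` is invertible and its ff block is the periodised interior comb leg -/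

section Main
variable {n : ℕ} [NeZero n] (p : ℕ) [NeZero p]

/-- [folklore] **TB1′ (M-SIDE, CHART (III′)): THE TORUS COMB-GAUGED SHARP KKT MATRIX OF THE LEGGED BORDER IS INVERTIBLE** —
`IsUnit (kkt K̂ (fromRows Q̂′ τ_T)).det` on every coarse torus, `τ_T := tauT (ctr (d+1) n) n p`, for every block side `n ≥ 1` and every coarse period `p ≥ 1`. -/
theorem isUnit_det_MTsh :
    IsUnit (kkt (Khat (d := d) n p) (Matrix.fromRows (QhatSh (d := d) n p) (tauT (ctr (d + 1) n) n p))).det := by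
  obtain ⟨h1, -, -, h4⟩ := torus_rules_comb (d := d) (n := n) p
  rw [blocksHat_sortK_axEc] at h1 h4
  rw [blocksHat_sortK_bhKStepSh_zero] at h4
  set G := blocksHat p (sortK n (GcombSh (d := d) n 0)) with hG
  set Sg : Matrix _ _ ℝ := Matrix.fromBlocks (1 : Matrix (I d n p) (I d n p) ℝ) 0 0
    (-1 : Matrix (J d p) (J d p) ℝ) with hSg
  refine isUnit_det_kkt_fromRows_of_relInv (Khat n p) (QhatSh n p) (tauT (ctr (d + 1) n) n p) (tauT_mul_transpose _ n p)
    (A := Sg * G) ?_ ?_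
  · rw [← Matrix.mul_assoc, sg_comm_E, Matrix.mul_assoc, h1]
  · rw [Matrix.mul_assoc, ← Matrix.mul_assoc (kkt _ _), ← Matrix.mul_assoc]
    exact h4

/-- [folklore] **TB1′ (M-SIDE, CHART (III′)): THE ff BLOCK OF `M′_T⁻¹` IS THE PERIODISED INTERIOR COMB LEG** —
`flucCov K̂ (fromRows Q̂′ τ_T) = (reblock n (blk (GcombSh n 0) true true))^`. -/
theorem flucCov_MTsh_eq :
    flucCov (Khat (d := d) n p) (Matrix.fromRows (QhatSh (d := d) n p) (tauT (ctr (d + 1) n) n p))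
      = Matrix.of (periodiseF p (reblock n (PackedKernelSplit.blk (GcombSh (d := d) n 0) true true))) := by
  obtain ⟨h1, -, -, h4⟩ := torus_rules_comb (d := d) (n := n) p
  rw [blocksHat_sortK_axEc] at h1 h4
  rw [blocksHat_sortK_bhKStepSh_zero] at h4
  set G := blocksHat p (sortK n (GcombSh (d := d) n 0)) with hG
  set Sg : Matrix _ _ ℝ := Matrix.fromBlocks (1 : Matrix (I d n p) (I d n p) ℝ) 0 0
    (-1 : Matrix (J d p) (J d p) ℝ) with hSg
  have hEA : Matrix.fromBlocks (1 - (tauT (ctr (d + 1) n) n p)ᵀ * tauT (ctr (d + 1) n) n p) 0 0 1 * (Sg * G) = Sg * G := by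
    rw [← Matrix.mul_assoc, sg_comm_E, Matrix.mul_assoc, h1]
  have hEMA : Matrix.fromBlocks (1 - (tauT (ctr (d + 1) n) n p)ᵀ * tauT (ctr (d + 1) n) n p) 0 0 1 * kkt (Khat n p) (QhatSh n p) * (Sg * G)
      = Matrix.fromBlocks (1 - (tauT (ctr (d + 1) n) n p)ᵀ * tauT (ctr (d + 1) n) n p) 0 0 1 := by
    rw [Matrix.mul_assoc, ← Matrix.mul_assoc (kkt _ _), ← Matrix.mul_assoc]
    exact h4
  have hb := (blocks_kkt_fromRows_of_relInv (Khat n p) (QhatSh n p) (tauT (ctr (d + 1) n) n p) (tauT_mul_transpose _ n p) hEA hEMA).1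
  rw [hb, hSg, hG, blocksHat, Matrix.fromBlocks_multiply]
  simp only [Matrix.one_mul, Matrix.zero_mul, add_zero, Matrix.toBlocks_fromBlocks₁₁, fTL_sortK]

set_option synthInstance.maxSize 512 in
/-- [folklore] **TB1′ (M-SIDE, CHART (III′)), THE PACKED `(fine ⊕ coarse)` CORNER OF `M′_T⁻¹` IS THE PERIODISED INTERIOR COMB PACK** (with the sign of
the multiplier ROWS flipped — the `[[δd, −𝒬′ᵀ],[𝒬′, 0]]` vs `kkt` convention): `(kkt K̂ (fromRows Q̂′ τ_T))⁻¹.submatrix e e = fromBlocks 1 0 0 (−1) · (sortK n (GcombSh n 0))^`,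
`e = Sum.map id Sum.inl`.  (Instance budget raised for `DecidableEq ((I ⊕ J) ⊕ CombRows)` as in TB1.) -/
theorem inv_MTsh_packed_eq :
    (kkt (Khat (d := d) n p) (Matrix.fromRows (QhatSh (d := d) n p) (tauT (ctr (d + 1) n) n p)))⁻¹.submatrix (Sum.map id Sum.inl) (Sum.map id Sum.inl)
      = Matrix.fromBlocks (1 : Matrix (I d n p) (I d n p) ℝ) 0 0 (-1 : Matrix (J d p) (J d p) ℝ)
          * blocksHat p (sortK n (GcombSh (d := d) n 0)) := by
  obtain ⟨h1, -, -, h4⟩ := torus_rules_comb (d := d) (n := n) p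
  rw [blocksHat_sortK_axEc] at h1 h4
  rw [blocksHat_sortK_bhKStepSh_zero] at h4
  set G := blocksHat p (sortK n (GcombSh (d := d) n 0)) with hG
  set Sg : Matrix _ _ ℝ := Matrix.fromBlocks (1 : Matrix (I d n p) (I d n p) ℝ) 0 0
    (-1 : Matrix (J d p) (J d p) ℝ) with hSg
  set τ := tauT (ctr (d + 1) n) n p with hτ
  have hEA : Matrix.fromBlocks (1 - τᵀ * τ) 0 0 1 * (Sg * G) = Sg * G := by
    rw [← Matrix.mul_assoc, sg_comm_E, Matrix.mul_assoc, h1]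
  have hEMA : Matrix.fromBlocks (1 - τᵀ * τ) 0 0 1 * kkt (Khat n p) (QhatSh n p) * (Sg * G) = Matrix.fromBlocks (1 - τᵀ * τ) 0 0 1 := by
    rw [Matrix.mul_assoc, ← Matrix.mul_assoc (kkt _ _), ← Matrix.mul_assoc]
    exact h4
  have hT : (Matrix.fromRows τᵀ (0 : Matrix (J d p) (CombRows (ctr (d + 1) n) n p) ℝ))ᵀ
      * Matrix.fromRows τᵀ (0 : Matrix (J d p) (CombRows (ctr (d + 1) n) n p) ℝ) = 1 := by
    rw [RelInvCombBorderedKKT.transpose_fromRows_mul_fromRows, hτ, tauT_mul_transpose]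
  have hE := (RelInvCombBorderedKKT.one_sub_fromRows_mul_transpose (μ := J d p) τ).symm
  have hc := RelInvCombBorderedKKT.toBlocks₁₁_inv_combBordered (M := kkt (Khat n p) (QhatSh n p)) hT hE hEA hEMA
  rw [← RelInvCombBorderedKKT.kkt_fromRows_submatrix_sumAssoc, Matrix.inv_submatrix_equiv] at hc
  rw [submatrix_map_inl_eq_toBlocks₁₁, hc]

end Main

end Summit.QuantumFields.BalabanUV.Beta.D1BFx.TorusCombKKTSh

end
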